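/-
Copyright (c) 2026. All rights reserved.
Released under Apache 2.0 license as described in the file LICENSE.
Authors: abc-iut cell, seat abc-iut-f-069 (gen 3; NON-VACUITY of the construction-data closers of Prop 1.3 (iii)).
-/
import Literature.AnabelianGeometry.AbsoluteAnabelian.AbsTopII.DPSCIndexDataOfEmbeddingCuspScope
import Literature.AnabelianGeometry.AbsoluteAnabelian.AbsTopII.DPSCIndexDataOfOuterActionProp13v
import Literature.AnabelianGeometry.AbsoluteAnabelian.AbsTopII.DPSCDataOfOuterActionWitness
import Literature.AnabelianGeometry.AbsoluteAnabelian.FreeProcyclicModel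
import Mathlib.NumberTheory.Padics.ProperSpace
import Mathlib.Topology.MetricSpace.Ultra.TotallySeparated

/-!
# [AbsTopII] Prop 1.3 (iii) (rest) holds UNCONDITIONALLY at a constructed DPSC-extension with inertia `ℤ_l`
# (the printed smooth case: "immediate from the definitions when `X` is smooth over `k`")

S. Mochizuki, *Topics in Absolute Anabelian Geometry II* [AbsTopII] (bib `MochizukiAbsTopII2013`), §1
Def 1.2 (ii) p. 10, Prop 1.3 (iii) p. 11 (proof p. 13: "The fact that this injection is, in fact,
surjective is immediate from the definitions when `X` is smooth over `k`"); [CombGC] (bib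
`MochizukiCombGC2007`) Def 1.1, Prop 1.2; [AbsAnab] Lemma 1.3.1 (slimness of pro-`Σ` surface groups; tree:
`proSigmaSurfaceGroupSlim_holds`).

PROOF-ONLY non-vacuity certificate (no definition) for abc-iut-f-069's construction-data closers
`DPSCIndexData.prop_1_3_iii'_ofOuterAction_of_dehn` / `prop_1_3_iii''_ofOuterAction_of_dehn`
(`AbsTopII/DPSCInertiaOfOuterActionZhat.lean` p443326, `…CuspScope.lean` p443957): at ONE kernel model ALL
their hypotheses are PROVED, so the typed [AbsTopII] Prop 1.3 (iii) (rest) — F-0299 `Prop_1_3_iii'` and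
abc-iut-L4-t6's `Π_𝔾`-scoped `Prop_1_3_iii''` — hold there with NO hypothesis.  MODEL (the printed SMOOTH
case over a log point with inertia `ℤ_l`): `Π_𝒢` = a pro-`l` completion of the genus-`2` surface group
(abc-iut-w5-d226's one-vertex witness shape, `AbsTopII/DPSCDataOfOuterActionWitness.lean`), the one-vertex
PSC datum of smooth proper shape (`Π_v = Π_𝒢`, no nodes, no cusps, `Σ = {l}`), the profinite group
`J := ℤ_l` (Mathlib's `PadicInt`, written multiplicatively) acting TRIVIALLY (`θ = 1`), inertia `I := J`:
then `Π_H = Π_I = Π_𝒢 ⋊^out_1 ℤ_l`, every outer class has the identity as a `Π_v`-fixing (Dehn-type)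
lift, `I = ℤ_l` is closed and free pro-`{l}`-cyclic (`isFreeProSigmaCyclic_singleton_padicInt`), [CombGC]
Prop 1.2 (ii) holds (the only verticial subgroup is `Π_𝒢`), and `Π_v` is slim ([AbsAnab] 1.3.1).
HONEST SCOPE: the smooth one-component configuration with trivial outer inertia action exercises the
construction, the `I_v ≃ₜ* I` transport and the Dehn-type input, not the nodal/cuspidal combinatorics
(no cusps: the cusp clause of (iii) is vacuous here).  Nothing here bears on [IUTchIII] Cor 3.12.
-/

noncomputable section

open scoped Pointwise

namespace Literature.AnabelianGeometry.AbsoluteAnabelian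

open Literature.AlgebraicGeometry.Frobenioids (IsSlimGroup)
open Literature.AnabelianGeometry.EtaleTheta (contMulAut mem_contMulAut TopOut)
open Literature.AnabelianGeometry.SemiGraphs
open Literature.AnabelianGeometry.SemiGraphs.SemiGraphOfAnabelioids (IsProSigmaCompletion)
open Literature.GroupTheory.CombinatorialGroupTheory
open Literature.AnabelianGeometry.Anabelioids (IsSigmaInteger)
open Topology

namespace AbsTopII.DPSCIndexData

/-- **[AbsTopII] Prop 1.3 (iii) (rest) — F-0299 `Prop_1_3_iii'` and the `Π_𝔾`-scoped `Prop_1_3_iii''` — hold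
UNCONDITIONALLY at a constructed DPSC-extension with inertia `I = ℤ_l` acting trivially** (the printed
smooth case): non-vacuity of `prop_1_3_iii'_ofOuterAction_of_dehn` / `prop_1_3_iii''_ofOuterAction_of_dehn`,
every hypothesis ([CombGC] Prop 1.2 (ii), slimness, Π_v-fixing lifts of `ρ_I`, `I` closed, `I ≅ Ẑ^Σ`)
being PROVED at the model.  Also recorded there, with NO hypothesis: t4's first clause `Prop13iii`
(F-0275), and Prop 1.3 (v) — t4's `Prop13v` (F-0278) and t6's middle clause `Prop_1_3_v'` (F-0300) —
through `prop13v_ofOuterAction_of_dehn` / `prop_1_3_v'_ofOuterAction_of_dehn` (graphic lifts = the identity;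
[CombGC] Prop 1.2 (i) trivial for one vertex; "(iv) at open subgroups" trivial since `Π_v = Π_𝔾` is normal).
[cite: MochizukiAbsTopII2013, Prop 1.3 (iii) p.11] [cite: MochizukiCombGC2007, Prop 1.2 p.8] -/
theorem exists_ofOuterAction_prop_1_3_iii' (l : ℕ) [Fact l.Prime] :
    ∃ (Q : ProfiniteGrp.{0}) (ι₀ : PuncturedSurfaceGroup 2 0 →* Q) (_ : IsProSigmaCompletion {l} ι₀)
      (G : PSCDatum Q) (hG : IsTopologicallyFinitelyGenerated Q)
      (J : Type) (_ : Group J) (_ : TopologicalSpace J) (_ : IsTopologicalGroup J) (_ : CompactSpace J)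
      (_ : TotallyDisconnectedSpace J) (θ : J →ₜ* outProfinite hG)
      (σ : G.graph.N → ℕ) (hσ : ∀ e, IsSigmaInteger G.Sigma (σ e)),
      G.Sigma = {l} ∧ (∀ v, G.vertGp v = ⊤) ∧ IsEmpty G.graph.N ∧ IsEmpty G.graph.C ∧ Nonempty G.graph.V ∧
      Nonempty (J ≃ₜ* Multiplicative ℤ_[l]) ∧ (∀ j, θ j = 1) ∧
      (DPSCData.ofOuterAction G hG θ ⊤).Prop13iii ∧
      Literature.AnabelianGeometry.AbsoluteAnabelian.AbsTopII.DPSCIndexData.Prop_1_3_iii'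
        (ofOuterAction G hG θ ⊤ σ hσ) ∧
      Literature.AnabelianGeometry.AbsoluteAnabelian.AbsTopII.DPSCIndexData.Prop_1_3_iii''
        (ofOuterAction G hG θ ⊤ σ hσ) ∧
      (DPSCData.ofOuterAction G hG θ ⊤).Prop13v ∧
      Literature.AnabelianGeometry.AbsoluteAnabelian.AbsTopII.DPSCIndexData.Prop_1_3_v'
        (ofOuterAction G hG θ ⊤ σ hσ) := by
  have hS₁ : ({l} : Set ℕ).Nonempty := ⟨l, rfl⟩
  have hS₂ : ∀ p ∈ ({l} : Set ℕ), p.Prime := fun p hp => by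
    rw [Set.mem_singleton_iff.mp hp]; exact Fact.out
  -- the group: a pro-`l` completion of the genus-2 surface group (as in abc-iut-w5-d226's witness)
  obtain ⟨Q, ι₀, hι₀⟩ := IsProSigmaCompletion.exists_isProSigmaCompletion (PuncturedSurfaceGroup 2 0) {l}
  have hG : IsTopologicallyFinitelyGenerated Q :=
    IsProSigmaCompletion.isTopologicallyFinitelyGenerated_of_puncturedSurfaceGroup (MulEquiv.refl _) hι₀
  have hslim : IsSlimGroup Q :=
    proSigmaSurfaceGroupSlim_holds {l} hS₁ hS₂ 2 0 (by change 2 < 2 * 2 + 0; norm_num) Q ι₀ hι₀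
  have hZ : Subgroup.center (Q : Type) = ⊥ := DPSCData.center_eq_bot_of_isSlimGroup' hslim
  -- the one-vertex PSC datum of smooth proper shape, `Σ = {l}`
  let graph : PSCSemiGraph :=
    { V := Unit, N := Empty, C := Empty, nodeEnds := fun e => e.elim, cuspEnd := fun c => c.elim }
  let G : PSCDatum Q :=
    { Sigma := {l}
      sigma_prime := hS₂
      sigma_nonempty := hS₁
      graph := graph
      vertGp := fun _ => ⊤
      nodeGp := fun e => e.elim
      cuspGp := fun c => c.elim
      genus := fun _ => 2
      isClosed_vertGp := fun _ => by simp
      isClosed_nodeGp := fun e => e.elim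
      isClosed_cuspGp := fun c => c.elim
      nodeGp_le := fun e => e.elim
      cuspGp_le := fun c => c.elim
      proSigma := DPSCData.isProSigma_of_isProSigmaCompletion hι₀ }
  have hCT : G.VerticialEdgeLikeCommensurablyTerminal := by
    rintro A (⟨v, γ, rfl⟩ | (⟨e, -, -⟩ | ⟨c, -, -⟩))
    · change Subgroup.Commensurable.commensurator (γ • (⊤ : Subgroup Q)) = γ • ⊤
      rw [PSCDatum.conjAct_smul_top, DPSCData.commensurator_top]
    · exact e.elim
    · exact c.elim
  have hslimv : ∀ w, IsSlimGroup ↥(G.vertGp w) := fun _ => DPSCData.isSlimGroup_top hslim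
  -- [CombGC] Prop 1.2 (i): one vertex
  have hDetV : G.VerticialOpenInterDeterminesVertex := fun v₁ v₂ _ _ _ => Subsingleton.elim v₁ v₂
  -- the inertia group `J := ℤ_l` (multiplicative notation), acting trivially
  let J : Type := Multiplicative ℤ_[l]
  haveI : TotallyDisconnectedSpace J := inferInstanceAs (TotallyDisconnectedSpace ℤ_[l])
  let θ : J →ₜ* outProfinite hG := 1
  -- Dehn-type lifts: the identity
  have hDehn : ∀ (v : G.graph.V) (i : J), i ∈ (⊤ : Subgroup J) → ∃ φ : (Q : Type) ≃ₜ* (Q : Type),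
      TopOut.mk (Q : Type) ⟨φ.toMulEquiv, (mem_contMulAut (Q : Type)).mpr ⟨φ.continuous, φ.symm.continuous⟩⟩ =
        outerActionOfContinuous hG θ i ∧ ∀ x ∈ G.vertGp v, φ x = x := by
    intro v i _
    refine ⟨ContinuousMulEquiv.refl _, ?_, fun x _ => rfl⟩
    have h1 : outerActionOfContinuous hG θ i = 1 := by
      change (outEquiv hG).symm.toMonoidHom ((1 : J →ₜ* outProfinite hG) i) = 1
      have h0 : ((1 : J →ₜ* outProfinite hG) i) = 1 := rfl
      rw [h0, map_one]
    have h2 : ∀ hc : (ContinuousMulEquiv.refl (Q : Type)).toMulEquiv ∈ contMulAut (Q : Type),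
        (⟨(ContinuousMulEquiv.refl (Q : Type)).toMulEquiv, hc⟩ : contMulAut (Q : Type)) = 1 :=
      fun _ => Subtype.ext rfl
    rw [h1, h2, map_one]
  -- `I = ⊤ ≤ ℤ_l` is closed and free pro-`{l}`-cyclic
  have hIc : IsClosed ((⊤ : Subgroup J) : Set J) := isClosed_univ
  let eTop : ↥(⊤ : Subgroup J) ≃ₜ* J :=
    { Subgroup.topEquiv with
      continuous_toFun := continuous_subtype_val
      continuous_invFun := by
        change Continuous fun g : J => (⟨g, Subgroup.mem_top g⟩ : ↥(⊤ : Subgroup J))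
        exact continuous_id.subtype_mk _ }
  have hI : IsFreeProSigmaCyclic G.Sigma ↥(⊤ : Subgroup J) :=
    (isFreeProSigmaCyclic_singleton_padicInt l).of_continuousMulEquiv eTop.symm
  -- (v): graphic lifts = the identity; "(iv) at open subgroups" is trivial since `Π_v = Π_𝔾` is normal
  have hθ : ∀ j : J, ∃ φ : (Q : Type) ≃ₜ* (Q : Type),
      TopOut.mk (Q : Type) ⟨φ.toMulEquiv, (mem_contMulAut (Q : Type)).mpr ⟨φ.continuous, φ.symm.continuous⟩⟩ =
        outerActionOfContinuous hG θ j ∧ G.IsGraphic G φ := fun j => by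
    obtain ⟨ψ, hψ, hfix⟩ := hDehn () j (Subgroup.mem_top j)
    refine ⟨ContinuousMulEquiv.refl _, ?_, PSCDatum.isGraphic_refl G⟩
    have : ψ = ContinuousMulEquiv.refl _ := by
      ext x; exact hfix x (Subgroup.mem_top x)
    rw [← this]; exact hψ
  have hL : ∀ (v : (DPSCData.ofOuterAction G hG θ ⊤).Vert) (g : (DPSCData.ofOuterAction G hG θ ⊤).PiH),
      (DPSCData.ofOuterAction G hG θ ⊤).Iv v ⊓ MulAut.conj g • (DPSCData.ofOuterAction G hG θ ⊤).Iv v ≠ ⊥ →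
        MulAut.conj g • (DPSCData.ofOuterAction G hG θ ⊤).vertSub v =
          (DPSCData.ofOuterAction G hG θ ⊤).vertSub v := by
    intro v g _
    have hv : (DPSCData.ofOuterAction G hG θ ⊤).vertSub v = (DPSCData.ofOuterAction G hG θ ⊤).PiG :=
      (MonoidHom.range_eq_map _).symm
    haveI := (DPSCData.ofOuterAction G hG θ ⊤).normal_PiG
    rw [hv]
    exact Subgroup.Normal.conj_smul_eq_self g _
  refine ⟨Q, ι₀, hι₀, G, hG, J, inferInstance, inferInstance, inferInstance, inferInstance, inferInstance,
    θ, (fun e => e.elim), (fun e => e.elim), rfl, fun _ => rfl, inferInstanceAs (IsEmpty Empty),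
    inferInstanceAs (IsEmpty Empty), ⟨()⟩, ⟨ContinuousMulEquiv.refl _⟩, fun _ => rfl, ?_, ?_, ?_, ?_, ?_⟩
  · exact DPSCData.prop13iii_ofOuterAction_of_fixing_lifts G hG hZ θ ⊤ hCT hslimv hDehn
  · exact prop_1_3_iii'_ofOuterAction_of_dehn G hG hZ θ ⊤ _ _ hCT hslimv hDehn hIc hI
  · exact prop_1_3_iii''_ofOuterAction_of_dehn G hG hZ θ ⊤ _ _ hCT hslimv hDehn hIc hI
  · exact prop13v_ofOuterAction_of_dehn G hG hZ θ ⊤ (DPSCData.isGraphic_conjAutOf_of_lifts G hG θ hθ)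
      hCT hDetV hslimv hDehn hIc hI hL
  · exact prop_1_3_v'_ofOuterAction_of_dehn G hG hZ θ ⊤ _ _ (DPSCData.isGraphic_conjAutOf_of_lifts G hG θ hθ)
      hCT hDetV hslimv hDehn hIc hI hL

end AbsTopII.DPSCIndexData

end Literature.AnabelianGeometry.AbsoluteAnabelian

end
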